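import Mathlib.Analysis.SpecialFunctions.Pow.Real
import Mathlib.Algebra.Order.BigOperators.Ring.Finset
import Mathlib.Algebra.Order.Floor.Semiring
import Mathlib.Data.Matrix.Mul
import Mathlib.Data.Fintype.BigOperators
import Literature.Barriers.PneNP.TSPExtensionComplexityHyperplaneBound
import HarnessLib

/-!
# T-SOC / fixed block size (cell pnp-psdrank, rung F-N2.SOC): the `ε`-net sandwich in dimension `d` by a coordinate grid

`netSandwich_grid`: for weights `W ≤ K` (`K ≥ 0`) with all rectangle sums `≤ θ₀` and vectors `a_x, b_y ∈ ℝ^d`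
of norm `≤ 1`: `Σ W⟪a,b⟫² ≤ (5184 d²/(η²τ))^d θ₀ + η Σ K⟪a,b⟫² + τ Σ K`. (Grid of mesh `η√τ/(24d)` on the raw
vectors; good cell pairs charged by ONE rectangle, garbage pairs pointwise.) Landing kit v2, pnp-psdrank-eng g3,
from the farm-checked work file HOME/pnp-psdrank-eng/lean/SocLiftB.lean (Part E).
-/

set_option linter.dupNamespace false -- `Summit.PneNP.PneNP.…`: summit = sub-problem (D-0017)

noncomputable section

open Finset Real

namespace Summit.PneNP.PneNP.Theorems.SmallBlockRothvossGrid

variable {d : ℕ}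

/-! ### Vectors of norm at most one -/

/-- Cauchy–Schwarz for `dotProduct`. -/
theorem dotProduct_sq_le_self_mul (u v : Fin d → ℝ) : (u ⬝ᵥ v) ^ 2 ≤ (u ⬝ᵥ u) * (v ⬝ᵥ v) := by
  have h := Finset.sum_mul_sq_le_sq_mul_sq univ u v
  simpa only [dotProduct, pow_two] using h

/-- Coordinates of a vector of norm `≤ 1` are at most `1` in absolute value. -/
theorem abs_apply_le_one {u : Fin d → ℝ} (hu : u ⬝ᵥ u ≤ 1) (k : Fin d) : |u k| ≤ 1 := by
  have h1 : u k * u k ≤ u ⬝ᵥ u := by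
    unfold dotProduct
    exact single_le_sum (f := fun j => u j * u j) (fun j _ => mul_self_nonneg _) (mem_univ k)
  have h2 : |u k| * |u k| ≤ 1 := by rw [abs_mul_abs_self]; linarith
  nlinarith [abs_nonneg (u k)]

/-! ### The grid -/

/-- Cell index of a vector: coordinatewise `⌊(u_k + 1)/h⌋`. -/
def gidx (h : ℝ) (u : Fin d → ℝ) (k : Fin d) : ℕ := ⌊(u k + 1) / h⌋₊

/-- Lower corner of the cell with index vector `g`. -/
def corner (h : ℝ) (g : Fin d → ℕ) : Fin d → ℝ := fun k => -1 + (g k : ℝ) * h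

/-- Number of cells per coordinate. -/
def gsize (h : ℝ) : ℕ := ⌊2 / h⌋₊ + 1

/-- The cell index of a bounded vector is `< gsize h`. -/
theorem gidx_lt {h : ℝ} (hh : 0 < h) {u : Fin d → ℝ} (hu : ∀ k, |u k| ≤ 1) (k : Fin d) :
    gidx h u k < gsize h := by
  have h1 : (u k + 1) / h ≤ 2 / h :=
    div_le_div_of_nonneg_right (by linarith [(abs_le.1 (hu k)).2]) hh.le
  have h2 := Nat.floor_mono h1
  unfold gidx gsize
  omega

/-- Each coordinate is within `h` of the cell corner. -/
theorem abs_sub_corner_le {h : ℝ} (hh : 0 < h) {u : Fin d → ℝ} (hu : ∀ k, |u k| ≤ 1) (k : Fin d) :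
    |u k - corner h (gidx h u) k| ≤ h := by
  have hx0 : 0 ≤ (u k + 1) / h := div_nonneg (by linarith [(abs_le.1 (hu k)).1]) hh.le
  have h1 : (⌊(u k + 1) / h⌋₊ : ℝ) ≤ (u k + 1) / h := Nat.floor_le hx0
  have h2 : (u k + 1) / h < ⌊(u k + 1) / h⌋₊ + 1 := Nat.lt_floor_add_one _
  have h1' : (⌊(u k + 1) / h⌋₊ : ℝ) * h ≤ u k + 1 := by
    have := mul_le_mul_of_nonneg_right h1 hh.le; rwa [div_mul_cancel₀ _ hh.ne'] at this
  have h2' : u k + 1 < ((⌊(u k + 1) / h⌋₊ : ℝ) + 1) * h := by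
    have := mul_lt_mul_of_pos_right h2 hh; rwa [div_mul_cancel₀ _ hh.ne'] at this
  unfold corner gidx
  rw [abs_le]
  constructor <;> nlinarith

/-- Corners of occupied cells have coordinates bounded by `2` (for `h ≤ 1`). -/
theorem abs_corner_le {h : ℝ} (hh : 0 < h) (hh1 : h ≤ 1) {u : Fin d → ℝ} (hu : ∀ k, |u k| ≤ 1)
    (k : Fin d) : |corner h (gidx h u) k| ≤ 2 := by
  have h1 := abs_sub_corner_le hh hu k
  have h2 := hu k
  have : |corner h (gidx h u) k| ≤ |u k| + |u k - corner h (gidx h u) k| := by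
    have := abs_sub_abs_le_abs_sub (u k) (corner h (gidx h u) k)
    have h' : |corner h (gidx h u) k| - |u k| ≤ |u k - corner h (gidx h u) k| := by
      rw [abs_sub_comm] ; linarith [abs_sub_abs_le_abs_sub (corner h (gidx h u) k) (u k)]
    linarith
  linarith

/-- **Deviation inside a cell pair**: `|⟪u,v⟫ − ⟪c_u, c_v⟫| ≤ 3hd` for the corners `c_u, c_v` of the cells
of `u, v` (vectors with coordinates in `[-1,1]`, mesh `h ≤ 1`). -/
theorem abs_dot_sub_corner_dot_le {h : ℝ} (hh : 0 < h) (hh1 : h ≤ 1) {u v : Fin d → ℝ}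
    (hu : ∀ k, |u k| ≤ 1) (hv : ∀ k, |v k| ≤ 1) :
    |u ⬝ᵥ v - corner h (gidx h u) ⬝ᵥ corner h (gidx h v)| ≤ 3 * h * d := by
  unfold dotProduct
  rw [← sum_sub_distrib]
  have hterm : ∀ k ∈ (univ : Finset (Fin d)),
      |u k * v k - corner h (gidx h u) k * corner h (gidx h v) k| ≤ 3 * h := by
    intro k _
    have e : u k * v k - corner h (gidx h u) k * corner h (gidx h v) k =
        (u k - corner h (gidx h u) k) * v k + corner h (gidx h u) k * (v k - corner h (gidx h v) k) := by
      ring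
    rw [e]
    have h1 : |(u k - corner h (gidx h u) k) * v k| ≤ h * 1 := by
      rw [abs_mul]; exact mul_le_mul (abs_sub_corner_le hh hu k) (hv k) (abs_nonneg _) hh.le
    have h2 : |corner h (gidx h u) k * (v k - corner h (gidx h v) k)| ≤ 2 * h := by
      rw [abs_mul]
      exact mul_le_mul (abs_corner_le hh hh1 hu k) (abs_sub_corner_le hh hv k) (abs_nonneg _)
        (by norm_num)
    calc |(u k - corner h (gidx h u) k) * v k + corner h (gidx h u) k * (v k - corner h (gidx h v) k)|
        ≤ |(u k - corner h (gidx h u) k) * v k| + |corner h (gidx h u) k * (v k - corner h (gidx h v) k)| :=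
          abs_add_le _ _
      _ ≤ 3 * h := by linarith
  calc |∑ k, (u k * v k - corner h (gidx h u) k * corner h (gidx h v) k)|
      ≤ ∑ k, |u k * v k - corner h (gidx h u) k * corner h (gidx h v) k| := abs_sum_le_sum_abs _ _
    _ ≤ ∑ _k : Fin d, 3 * h := sum_le_sum hterm
    _ = 3 * h * d := by rw [sum_const, card_univ, Fintype.card_fin, nsmul_eq_mul]; ring

/-! ### Pointwise steps (as in the planar case) -/

/-- Pointwise sandwich with a constant minorant: if `clo ≤ G ≤ chi`, `chi ≤ (1+η) clo`, `K ≥ 0`,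
`K - W ≥ 0`, then `W·G ≤ clo·W + η·K·G`. -/
theorem pointwise_sandwich_const {W K G clo chi η : ℝ} (hK : 0 ≤ K) (hKW : W ≤ K)
    (hη : 0 ≤ η) (hchi : chi ≤ (1 + η) * clo) (hlo : clo ≤ G) (hhi : G ≤ chi) :
    W * G ≤ clo * W + η * (K * G) := by
  have h1 : K * G ≤ K * ((1 + η) * clo) := mul_le_mul_of_nonneg_left (hhi.trans hchi) hK
  have h2 : (K - W) * clo ≤ (K - W) * G := mul_le_mul_of_nonneg_left hlo (by linarith)
  have h3 : η * (K * clo) ≤ η * (K * G) := mul_le_mul_of_nonneg_left (mul_le_mul_of_nonneg_left hlo hK) hη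
  nlinarith [h1, h2, h3]

/-! ### One cell pair -/

section Cell

variable {α β : Type} [Fintype α] [Fintype β]

omit [Fintype α] [Fintype β] in
/-- **One cell pair**: rows `X` and columns `Y` such that `|⟪a x, b y⟫|` is within `w` of a common value
`κ` on `X × Y`; then `Σ_{X×Y} W⟪a,b⟫² ≤ θ₀ + η Σ_{X×Y} K⟪a,b⟫² + τ Σ_{X×Y} K`
(good pairs: the rectangle bound once; garbage pairs: pointwise). -/
theorem cell_pair_bound (W K : α → β → ℝ) (θ₀ η τ : ℝ) (a : α → Fin d → ℝ) (b : β → Fin d → ℝ)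
    (hK0 : ∀ x y, 0 ≤ K x y) (hWK : ∀ x y, W x y ≤ K x y) (hθ : 0 ≤ θ₀) (hη : 0 < η) (hη1 : η ≤ 1)
    (hτ : 0 < τ) (ha : ∀ x, a x ⬝ᵥ a x ≤ 1) (hb : ∀ y, b y ⬝ᵥ b y ≤ 1)
    (hrect : ∀ (X : Finset α) (Y : Finset β), ∑ x ∈ X, ∑ y ∈ Y, W x y ≤ θ₀)
    {w κ : ℝ} (hw : 0 < w) (hF1 : (8 * w / η) ^ 2 ≤ τ) (X : Finset α) (Y : Finset β)
    (hdev : ∀ x ∈ X, ∀ y ∈ Y, |(|a x ⬝ᵥ b y|) - κ| ≤ w) :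
    ∑ x ∈ X, ∑ y ∈ Y, W x y * (a x ⬝ᵥ b y) ^ 2 ≤
      θ₀ + η * ∑ x ∈ X, ∑ y ∈ Y, K x y * (a x ⬝ᵥ b y) ^ 2 + τ * ∑ x ∈ X, ∑ y ∈ Y, K x y := by
  classical
  set G : α → β → ℝ := fun x y => (a x ⬝ᵥ b y) ^ 2 with hGdef
  have hG0 : ∀ x y, 0 ≤ G x y := fun x y => sq_nonneg _
  have hself : ∀ u : Fin d → ℝ, 0 ≤ u ⬝ᵥ u := fun u => by
    unfold dotProduct; exact sum_nonneg fun j _ => mul_self_nonneg _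
  have hG1 : ∀ x y, G x y ≤ 1 := fun x y =>
    (dotProduct_sq_le_self_mul (a x) (b y)).trans (mul_le_one₀ (ha x) (hself _) (hb y))
  have hPX0 : 0 ≤ ∑ x ∈ X, ∑ y ∈ Y, K x y * G x y :=
    sum_nonneg fun x _ => sum_nonneg fun y _ => mul_nonneg (hK0 x y) (hG0 x y)
  have hQX0 : 0 ≤ ∑ x ∈ X, ∑ y ∈ Y, K x y := sum_nonneg fun x _ => sum_nonneg fun y _ => hK0 x y
  by_cases hgood : (6 / η + 1) * w ≤ κ
  · -- good cell pair
    set clo : ℝ := (κ - w) ^ 2 with hclo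
    set chi : ℝ := (κ + w) ^ 2 with hchi
    have hκw : 6 * w / η ≤ κ - w := by
      have : (6 / η + 1) * w = 6 * w / η + w := by ring
      linarith
    have hκw0 : 0 < κ - w := lt_of_lt_of_le (by positivity) hκw
    have hclo0 : 0 < clo := by positivity
    have hratio : chi ≤ (1 + η) * clo := by
      -- `(κ + w)² ≤ (1 + η)(κ − w)²` for `κ ≥ (6/η + 1) w`
      rw [hchi, hclo]
      have hu6 : 6 * w ≤ η * (κ - w) := by
        have h' : 6 / η * w ≤ κ - w := by
          have : (6 / η + 1) * w = 6 / η * w + w := by ring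
          linarith
        have := mul_le_mul_of_nonneg_left h' hη.le
        rwa [← mul_assoc, mul_div_cancel₀ _ hη.ne'] at this
      have hu2 : 2 * w ≤ κ - w := by nlinarith
      have hu0 : 0 ≤ κ - w := by linarith
      have hk : κ + w = (κ - w) + 2 * w := by ring
      rw [hk]
      nlinarith [mul_nonneg hu0 hw.le, mul_nonneg hη.le (mul_nonneg hu0 hu0)]
    have hsand : ∀ x ∈ X, ∀ y ∈ Y, clo ≤ G x y ∧ G x y ≤ chi := by
      intro x hx y hy
      have hdv := abs_le.1 (hdev x hx y hy)
      have hlo : κ - w ≤ |a x ⬝ᵥ b y| := by linarith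
      have hhi : |a x ⬝ᵥ b y| ≤ κ + w := by linarith
      constructor
      · rw [hclo, hGdef]; dsimp only; rw [← sq_abs (a x ⬝ᵥ b y)]
        exact pow_le_pow_left₀ hκw0.le hlo 2
      · rw [hchi, hGdef]; dsimp only; rw [← sq_abs (a x ⬝ᵥ b y)]
        exact pow_le_pow_left₀ (abs_nonneg _) hhi 2
    have hsum1 : ∑ x ∈ X, ∑ y ∈ Y, W x y * G x y ≤
        clo * ∑ x ∈ X, ∑ y ∈ Y, W x y + η * ∑ x ∈ X, ∑ y ∈ Y, K x y * G x y := by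
      rw [mul_sum, mul_sum, ← sum_add_distrib]
      refine sum_le_sum fun x hx => ?_
      rw [mul_sum, mul_sum, ← sum_add_distrib]
      refine sum_le_sum fun y hy => ?_
      obtain ⟨hlo, hhi⟩ := hsand x hx y hy
      exact pointwise_sandwich_const (hK0 x y) (hWK x y) hη.le hratio hlo hhi
    -- `clo ≤ 1` unless the cell pair is empty
    by_cases hne : (X ×ˢ Y).Nonempty
    · obtain ⟨⟨x₀, y₀⟩, hxy⟩ := hne
      rw [mem_product] at hxy
      have hclo1 : clo ≤ 1 := ((hsand x₀ hxy.1 y₀ hxy.2).1).trans (hG1 x₀ y₀)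
      have hcθ : clo * ∑ x ∈ X, ∑ y ∈ Y, W x y ≤ θ₀ := by
        have h1 := hrect X Y
        by_cases hZ : 0 ≤ ∑ x ∈ X, ∑ y ∈ Y, W x y
        · calc clo * ∑ x ∈ X, ∑ y ∈ Y, W x y ≤ 1 * ∑ x ∈ X, ∑ y ∈ Y, W x y :=
              mul_le_mul_of_nonneg_right hclo1 hZ
            _ ≤ θ₀ := by rw [one_mul]; exact h1
        · push Not at hZ
          have : clo * ∑ x ∈ X, ∑ y ∈ Y, W x y ≤ 0 := mul_nonpos_of_nonneg_of_nonpos hclo0.le hZ.le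
          linarith
      linarith [mul_nonneg hτ.le hQX0]
    · rw [not_nonempty_iff_eq_empty, product_eq_empty] at hne
      rcases hne with hX | hY
      · rw [hX]; simp only [sum_empty, mul_zero, add_zero]; exact hθ
      · rw [hY]; simp only [sum_empty, sum_const_zero, mul_zero, add_zero]; exact hθ
  · -- garbage cell pair
    push Not at hgood
    have hGτ : ∀ x ∈ X, ∀ y ∈ Y, G x y ≤ τ := by
      intro x hx y hy
      have hdv := abs_le.1 (hdev x hx y hy)
      have hcos : |a x ⬝ᵥ b y| ≤ 8 * w / η := by
        have h1 : |a x ⬝ᵥ b y| ≤ κ + w := by linarith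
        have h2 : κ + w ≤ (6 / η + 2) * w := by linarith
        have h3 : (6 / η + 2) * w ≤ 8 * w / η := by
          rw [le_div_iff₀ hη]
          have : (6 / η + 2) * w * η = 6 * w + 2 * w * η := by field_simp
          rw [this]
          nlinarith
        linarith
      have : G x y ≤ (8 * w / η) ^ 2 := by
        rw [hGdef]; dsimp only; rw [← sq_abs (a x ⬝ᵥ b y)]
        exact pow_le_pow_left₀ (abs_nonneg _) hcos 2
      exact this.trans hF1
    have hgarb : ∑ x ∈ X, ∑ y ∈ Y, W x y * G x y ≤ τ * ∑ x ∈ X, ∑ y ∈ Y, K x y := by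
      rw [mul_sum]
      refine sum_le_sum fun x hx => ?_
      rw [mul_sum]
      refine sum_le_sum fun y hy => ?_
      have h1 : K x y * G x y ≤ K x y * τ := mul_le_mul_of_nonneg_left (hGτ x hx y hy) (hK0 x y)
      have h2 : W x y * G x y ≤ K x y * G x y := mul_le_mul_of_nonneg_right (hWK x y) (hG0 x y)
      linarith
    linarith [mul_nonneg hη.le hPX0]

end Cell

/-! ### The grid sandwich -/

section Main

variable {α β : Type} [Fintype α] [Fintype β]

/-- **The `ε`-net sandwich in dimension `d` (all-rectangle form, vectors of norm `≤ 1`).** -/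
theorem netSandwich_grid (hd : 1 ≤ d) (W K : α → β → ℝ) (θ₀ η τ : ℝ) (a : α → Fin d → ℝ)
    (b : β → Fin d → ℝ) (hK0 : ∀ x y, 0 ≤ K x y) (hWK : ∀ x y, W x y ≤ K x y) (hθ : 0 ≤ θ₀)
    (hη : 0 < η) (hη1 : η ≤ 1) (hτ : 0 < τ) (ha : ∀ x, a x ⬝ᵥ a x ≤ 1) (hb : ∀ y, b y ⬝ᵥ b y ≤ 1)
    (hrect : ∀ (X : Finset α) (Y : Finset β), ∑ x ∈ X, ∑ y ∈ Y, W x y ≤ θ₀) :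
    ∑ x, ∑ y, W x y * (a x ⬝ᵥ b y) ^ 2 ≤
      (5184 * (d : ℝ) ^ 2 / (η ^ 2 * τ)) ^ d * θ₀
        + η * ∑ x, ∑ y, K x y * (a x ⬝ᵥ b y) ^ 2 + τ * ∑ x, ∑ y, K x y := by
  classical
  set G : α → β → ℝ := fun x y => (a x ⬝ᵥ b y) ^ 2 with hGdef
  have hself : ∀ u : Fin d → ℝ, 0 ≤ u ⬝ᵥ u := fun u => by
    unfold dotProduct; exact sum_nonneg fun j _ => mul_self_nonneg _
  have hG0 : ∀ x y, 0 ≤ G x y := fun x y => sq_nonneg _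
  have hG1 : ∀ x y, G x y ≤ 1 := fun x y =>
    (dotProduct_sq_le_self_mul (a x) (b y)).trans (mul_le_one₀ (ha x) (hself _) (hb y))
  have hP0 : 0 ≤ ∑ x, ∑ y, K x y * G x y :=
    sum_nonneg fun x _ => sum_nonneg fun y _ => mul_nonneg (hK0 x y) (hG0 x y)
  have hQ0 : 0 ≤ ∑ x, ∑ y, K x y := sum_nonneg fun x _ => sum_nonneg fun y _ => hK0 x y
  have hd0 : (0 : ℝ) < d := by exact_mod_cast hd
  have hC0 : 0 ≤ (5184 * (d : ℝ) ^ 2 / (η ^ 2 * τ)) ^ d * θ₀ := by positivity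
  by_cases hτ1 : 1 ≤ τ
  · -- everything is garbage
    have hpt : ∀ x y, W x y * G x y ≤ τ * K x y := by
      intro x y
      have h1 : W x y * G x y ≤ K x y * G x y := mul_le_mul_of_nonneg_right (hWK x y) (hG0 x y)
      have h2 : K x y * G x y ≤ K x y * τ :=
        mul_le_mul_of_nonneg_left ((hG1 x y).trans hτ1) (hK0 x y)
      linarith
    calc ∑ x, ∑ y, W x y * G x y ≤ ∑ x, ∑ y, τ * K x y :=
          sum_le_sum fun x _ => sum_le_sum fun y _ => hpt x y
      _ = τ * ∑ x, ∑ y, K x y := by simp_rw [mul_sum]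
      _ ≤ _ := by nlinarith [mul_nonneg hη.le hP0]
  push Not at hτ1
  -- the mesh
  set sτ : ℝ := Real.sqrt τ with hsτ
  have hsτ0 : 0 < sτ := Real.sqrt_pos.2 hτ
  have hsτ1 : sτ ≤ 1 := by rw [hsτ]; exact Real.sqrt_le_one.mpr hτ1.le
  have hss : sτ ^ 2 = τ := by rw [hsτ]; exact Real.sq_sqrt hτ.le
  set h : ℝ := η * sτ / (24 * d) with hhdef
  have hh0 : 0 < h := by rw [hhdef]; positivity
  have hh1 : h ≤ 1 := by
    rw [hhdef, div_le_one (by positivity)]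
    have : η * sτ ≤ 1 * 1 := mul_le_mul hη1 hsτ1 hsτ0.le zero_le_one
    have hd1 : (1 : ℝ) ≤ d := by exact_mod_cast hd
    linarith
  set w : ℝ := 3 * h * d with hwdef
  have hw0 : 0 < w := by rw [hwdef]; positivity
  have hwη : 8 * w / η = sτ := by
    rw [hwdef, hhdef]; field_simp; norm_num
  have hF1 : (8 * w / η) ^ 2 ≤ τ := by rw [hwη, hss]
  -- coordinates are bounded by one
  have haco : ∀ x k, |a x k| ≤ 1 := fun x k => abs_apply_le_one (ha x) k
  have hbco : ∀ y k, |b y k| ≤ 1 := fun y k => abs_apply_le_one (hb y) k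
  -- cells
  set J : ℕ := gsize h with hJdef
  let cA : α → (Fin d → Fin J) := fun x k => ⟨gidx h (a x) k, gidx_lt hh0 (haco x) k⟩
  let cB : β → (Fin d → Fin J) := fun y k => ⟨gidx h (b y) k, gidx_lt hh0 (hbco y) k⟩
  -- per cell pair
  have hcell : ∀ (g g' : Fin d → Fin J),
      ∑ x ∈ univ.filter (fun x => cA x = g), ∑ y ∈ univ.filter (fun y => cB y = g'), W x y * G x y ≤
        θ₀ + η * ∑ x ∈ univ.filter (fun x => cA x = g), ∑ y ∈ univ.filter (fun y => cB y = g'),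
          K x y * G x y
          + τ * ∑ x ∈ univ.filter (fun x => cA x = g), ∑ y ∈ univ.filter (fun y => cB y = g'),
            K x y := by
    intro g g'
    refine cell_pair_bound W K θ₀ η τ a b hK0 hWK hθ hη hη1 hτ ha hb hrect hw0 hF1 _ _
      (κ := |corner h (fun k => ((g k : ℕ))) ⬝ᵥ corner h (fun k => ((g' k : ℕ)))|) ?_
    intro x hx y hy
    have hxg : gidx h (a x) = fun k => ((g k : ℕ)) := by
      funext k
      exact congrArg Fin.val (congrFun (mem_filter.1 hx).2 k)
    have hyg : gidx h (b y) = fun k => ((g' k : ℕ)) := by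
      funext k
      exact congrArg Fin.val (congrFun (mem_filter.1 hy).2 k)
    have hdv := abs_dot_sub_corner_dot_le hh0 hh1 (haco x) (hbco y)
    rw [hxg, hyg] at hdv
    calc |(|a x ⬝ᵥ b y|) - (|corner h (fun k => ((g k : ℕ))) ⬝ᵥ corner h (fun k => ((g' k : ℕ)))|)|
        ≤ |a x ⬝ᵥ b y - corner h (fun k => ((g k : ℕ))) ⬝ᵥ corner h (fun k => ((g' k : ℕ)))| :=
          abs_abs_sub_abs_le_abs_sub _ _
      _ ≤ 3 * h * d := hdv
      _ = w := by rw [hwdef]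
  -- decomposition along the cells
  have hdecomp : ∀ F : α → β → ℝ, ∑ x, ∑ y, F x y =
      ∑ g : Fin d → Fin J, ∑ g' : Fin d → Fin J, ∑ x ∈ univ.filter (fun x => cA x = g),
        ∑ y ∈ univ.filter (fun y => cB y = g'), F x y := by
    intro F
    rw [← Finset.sum_fiberwise univ cA (fun x => ∑ y, F x y)]
    refine sum_congr rfl fun g _ => ?_
    rw [sum_congr rfl fun x _ => (Finset.sum_fiberwise univ cB (F x)).symm, Finset.sum_comm]
  -- the count
  have hcard : ((Fintype.card (Fin d → Fin J) : ℕ) : ℝ) ^ 2 ≤ (5184 * (d : ℝ) ^ 2 / (η ^ 2 * τ)) ^ d := by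
    rw [Fintype.card_fun, Fintype.card_fin, Fintype.card_fin]
    push_cast
    have hJ : (J : ℝ) ≤ 3 / h := by
      rw [hJdef, gsize]
      push_cast
      have h1 : (⌊2 / h⌋₊ : ℝ) ≤ 2 / h := Nat.floor_le (by positivity)
      have h2 : (1 : ℝ) ≤ 1 / h := by rw [le_div_iff₀ hh0]; linarith
      have : 2 / h + 1 / h = 3 / h := by ring
      linarith
    have hJ0 : (0 : ℝ) ≤ J := Nat.cast_nonneg J
    have hJ2 : (J : ℝ) ^ 2 ≤ 5184 * (d : ℝ) ^ 2 / (η ^ 2 * τ) := by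
      have h3 : (3 / h) ^ 2 = 5184 * (d : ℝ) ^ 2 / (η ^ 2 * τ) := by
        rw [hhdef, ← hss]; field_simp; ring
      rw [← h3]
      exact pow_le_pow_left₀ hJ0 hJ 2
    calc ((J : ℝ) ^ d) ^ 2 = ((J : ℝ) ^ 2) ^ d := by ring
      _ ≤ (5184 * (d : ℝ) ^ 2 / (η ^ 2 * τ)) ^ d := pow_le_pow_left₀ (sq_nonneg _) hJ2 d
  -- assemble
  rw [hdecomp (fun x y => W x y * G x y), hdecomp (fun x y => K x y * G x y), hdecomp K]
  calc ∑ g : Fin d → Fin J, ∑ g' : Fin d → Fin J, ∑ x ∈ univ.filter (fun x => cA x = g),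
          ∑ y ∈ univ.filter (fun y => cB y = g'), W x y * G x y
      ≤ ∑ g : Fin d → Fin J, ∑ g' : Fin d → Fin J, (θ₀
          + η * ∑ x ∈ univ.filter (fun x => cA x = g), ∑ y ∈ univ.filter (fun y => cB y = g'),
              K x y * G x y
          + τ * ∑ x ∈ univ.filter (fun x => cA x = g), ∑ y ∈ univ.filter (fun y => cB y = g'),
              K x y) := sum_le_sum fun g _ => sum_le_sum fun g' _ => hcell g g'
    _ = ((Fintype.card (Fin d → Fin J) : ℕ) : ℝ) ^ 2 * θ₀
          + η * ∑ g : Fin d → Fin J, ∑ g' : Fin d → Fin J, ∑ x ∈ univ.filter (fun x => cA x = g),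
              ∑ y ∈ univ.filter (fun y => cB y = g'), K x y * G x y
          + τ * ∑ g : Fin d → Fin J, ∑ g' : Fin d → Fin J, ∑ x ∈ univ.filter (fun x => cA x = g),
              ∑ y ∈ univ.filter (fun y => cB y = g'), K x y := by
        simp only [sum_add_distrib, sum_const, card_univ, nsmul_eq_mul, ← mul_sum]
        ring
    _ ≤ _ := by
        have := mul_le_mul_of_nonneg_right hcard hθ
        linarith [this]

end Main

end Summit.PneNP.PneNP.Theorems.SmallBlockRothvossGrid

end
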